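import Literature.NumberTheory.Automorphic.UnitaryCayleyMomentMap
import Literature.LinearAlgebra.Semilinear.HermitianOrthogonalBasis
import Mathlib.LinearAlgebra.Matrix.SesquilinearForm
import Mathlib.LinearAlgebra.Matrix.NonsingularInverse
import HarnessLib

/-!
# Elements of a unitary group attached to an isotropic line with a hyperbolic partner: root elements (the
# Heisenberg unipotent radical `N_x`), the Levi dilations of the line, and the orthogonal decomposition
# `V = S x ⊕ S y ⊕ V₀`

Topic `NumberTheory/Automorphic`; namespace `Literature.NumberTheory.Automorphic.UnitaryGroup` (continues
`UnitaryGroupSymplecticEmbedding` §4: `hermForm σ H x y = (σ x)ᵀ H y`, and `UnitaryGroupAutomorphicRep`: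
`unitaryGroupOfForm σ H = {g ∈ GLₙ(S) ∣ (σ g)ᵀ H g = H}` — cited, not restated).  KERNEL ONLY: definitions with bodies
and theorems; no named fact, no `sorry`.

**Setting.** `S` a commutative ring, `σ : S →+* S` (an involution where stated, `hσ`), `H ∈ Mₙ(S)` (`σ`-hermitian
where stated: `hH : (H.map σ)ᵀ = H`), `h = hermForm σ H` (`σ`-semilinear in the first variable, linear in the
second); an ISOTROPIC vector `x` (`h(x,x) = 0`) and, for the Levi and the decomposition, a HYPERBOLIC PARTNER `y`
(`h(y,y) = 0`, `h(x,y) = 1` — we normalise by `1`, not by a trace-zero `θ₀`).  These are the explicit elements of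
the parabolic `P_x ⊂ U(h)` of the isotropic line `S x` ([Dieudonne1971GroupesClassiques, Chap. II §5]: unitary
transvections and root elements generating `T_n(K, f)`; [MoeglinVignerasWaldspurger1987, Chap. 3 §IV.2]: the parabolic
of an isotropic line of a hermitian space and its Heisenberg unipotent radical), as NAMED MATRICES in
`unitaryGroupOfForm σ H ≤ GLₙ(S)` — the form in which the tree's `toSymplectic : U(h) →* Sp(Res V)`
(`UnitaryGroupSymplecticEmbedding`) consumes them.  The same formulas, as endomorphisms of an abstract space, drive the
tree's `UnitaryIsotropicCharactersDet` (§4 root elements, §5 dilations); here they are matrices with `mulVec` formulas.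

* §1 the pairing: `hermRow σ H x = (σ x)ᵀ H` (`hermRow ⬝ᵥ v = h(x, v)`), additivity / `σ`-semilinearity of `h`,
  `h(eᵢ, eⱼ) = Hᵢⱼ`, and **`mem_unitaryGroupOfForm_iff_hermForm`**: `g ∈ U(σ,H) ↔ ∀ v w, h(g v, g w) = h(v, w)`.
* §2 **root elements** `lineRoot σ H x w z = 1 + w ⊗ h(x,·) + x ⊗ (z h(x,·) − h(w,·))`, i.e.
  `v ↦ v + h(x,v) w + (z h(x,v) − h(w,v)) x` (`lineRoot_mulVec`): for `w = 0`, `z = t` with `t + σ t = 0` these are the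
  TRANSVECTIONS `n_t : v ↦ v + t h(x,v) x` of the line (centre of `N_x`); for `w = b ⊥ x` and `z + σ z + h(b,b) = 0`
  the EICHLER / SIEGEL elements `n(b)`.  Heisenberg law **`lineRoot_mul_lineRoot`**:
  `T(w,z) T(w',z') = T(w + w', z + z' − h(w,w'))`, `T(0,0) = 1`, the unit `lineRootGL`, and
  **`lineRootGL_mem`**: `T(w,z) ∈ U(σ,H)` when `h(x,w) = 0` and `z + σ z + h(w,w) = 0` (`lineRoot_isometry`).
* §3 **dilations of the line** `lineDilation σ H x y α β = 1 + x ⊗ (α−1) h(y,·) + y ⊗ (β−1) h(x,·)`: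
  `x ↦ α x`, `y ↦ β y`, `v ↦ v` on `{x,y}^⊥`; multiplicative in `(α, β)`; the unit `lineDilationGL` (`α, β ∈ Sˣ`);
  **`lineDilationGL_mem`**: in `U(σ,H)` when `σ(α) β = 1` (so `m_λ = D(λ, (σλ)⁻¹)` is the Levi element of `λ ∈ Sˣ`);
  **`lineDilation_mul_lineRoot`** / **`lineDilation_mul_lineRoot_mul_lineDilation_inv`**:
  `D(α,β) T(w,z) = T(β′ w, α β′ z) D(α,β)` (`β β′ = 1`, `σ β′ = α`), `D(α,β) T(w,z) D(α,β)⁻¹ = T(β⁻¹ w, α β⁻¹ z)` for `w ⊥ x, y`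
  — the Levi acts on `N_x`, on its centre through the norm-type character `α β⁻¹ = λ σ(λ)`.
* §4 the decomposition `v = h(y,v) x + h(x,v) y + lineProj v` with `lineProj v ⊥ x, y`; the submodule
  `lineCompl σ H x y = {v ∣ h(x,v) = 0 = h(y,v)}`.
* §5 over a FIELD `K` with `2 ≠ 0` and `σ δ = −δ ≠ 0`: a hyperbolic partner exists for every non-zero isotropic `x` when
  `det H ≠ 0` (`exists_hyperbolic_partner_hermForm`), and **`lineCompl` has an `h`-orthogonal basis**
  (`exists_orthogonal_basis_lineCompl`, from the tree's `Semilinear.exists_orthogonal_basis_of_isSymm`).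

Written for the cell `hodgecm-mathlib` (fan B, rung B-IV; second token «Heisenberg-parabolic Kirillov» on
`mvw_IV4_rankOne_irreducibleOrZero`, file (3) of B-p04's plan: the elements `n_t`, `m_λ`, `n(b)` of `U(J)(F_v)` to be
conjugated into the adapted symplectic frame).  Nothing about theta lifts is asserted here.

## References
* [Dieudonne1971GroupesClassiques] J. Dieudonné, *La géométrie des groupes classiques*, 3e éd. (1971), Chap. II §§4–5.
* [MoeglinVignerasWaldspurger1987] C. Mœglin, M.-F. Vignéras, J.-L. Waldspurger, LNM 1291 (1987), Chap. 1 I.17,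
  Chap. 3 §IV.2.
* [Lang2002] S. Lang, *Algebra*, GTM 211 (2002), Ch. XV §5 (orthogonal bases of hermitian forms).
-/

set_option autoImplicit false

noncomputable section

namespace Literature.NumberTheory.Automorphic.UnitaryGroup

open _root_.Matrix

/-! ## §1 The pairing `h(x, y) = (σ x)ᵀ H y`: rows, sesquilinearity, and the isometry criterion -/

section Pairing

variable {S : Type*} [CommRing S] (σ : S →+* S) {n : Type*} [Fintype n] [DecidableEq n] (H : Matrix n n S)

/-- the row vector `(σ x)ᵀ H` of the functional `h(x, ·)`. [cite: Dieudonne1971GroupesClassiques, Chap. II §5] -/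
def hermRow (x : n → S) : n → S := (⇑σ ∘ x) ᵥ* H

omit [DecidableEq n] in
/-- `hermRow x ⬝ᵥ v = h(x, v)`. [cite: Dieudonne1971GroupesClassiques, Chap. II §5] -/
theorem hermRow_dotProduct (x v : n → S) : hermRow σ H x ⬝ᵥ v = hermForm σ H x v := by
  rw [hermRow, hermForm_apply, Matrix.dotProduct_mulVec]

/-- `h` is additive in the second variable. [cite: MoeglinVignerasWaldspurger1987, Chap. 1 I.17] -/
theorem hermForm_add_right (x v w : n → S) : hermForm σ H x (v + w) = hermForm σ H x v + hermForm σ H x w := by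
  rw [← toLinearMapₛₗ₂'_eq_hermForm, ← toLinearMapₛₗ₂'_eq_hermForm, ← toLinearMapₛₗ₂'_eq_hermForm, map_add]

/-- `h` is additive in the first variable. [cite: MoeglinVignerasWaldspurger1987, Chap. 1 I.17] -/
theorem hermForm_add_left (v w y : n → S) : hermForm σ H (v + w) y = hermForm σ H v y + hermForm σ H w y := by
  rw [← toLinearMapₛₗ₂'_eq_hermForm, ← toLinearMapₛₗ₂'_eq_hermForm, ← toLinearMapₛₗ₂'_eq_hermForm, map_add,
    LinearMap.add_apply]

/-- `h` is `σ`-semilinear in the first variable: `h(c v, y) = σ(c) h(v, y)` (the tree's `hermForm_smul_left` of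
`UnitaryGroupLocalReflections`, restated here to keep the imports algebraic). [cite: MoeglinVignerasWaldspurger1987, Chap. 1 I.17] -/
theorem hermForm_smul_left_eq (c : S) (v y : n → S) : hermForm σ H (c • v) y = σ c * hermForm σ H v y := by
  rw [← toLinearMapₛₗ₂'_eq_hermForm, ← toLinearMapₛₗ₂'_eq_hermForm, LinearMap.map_smulₛₗ, LinearMap.smul_apply,
    smul_eq_mul]

/-- `h(−v, y) = −h(v, y)`. [cite: MoeglinVignerasWaldspurger1987, Chap. 1 I.17] -/
theorem hermForm_neg_left (v y : n → S) : hermForm σ H (-v) y = -hermForm σ H v y := by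
  rw [← toLinearMapₛₗ₂'_eq_hermForm, ← toLinearMapₛₗ₂'_eq_hermForm, map_neg, LinearMap.neg_apply]

/-- `h(x, −v) = −h(x, v)`. [cite: MoeglinVignerasWaldspurger1987, Chap. 1 I.17] -/
theorem hermForm_neg_right (x v : n → S) : hermForm σ H x (-v) = -hermForm σ H x v := by
  rw [← toLinearMapₛₗ₂'_eq_hermForm, ← toLinearMapₛₗ₂'_eq_hermForm, map_neg]

/-- `h(v − w, y) = h(v, y) − h(w, y)`. [cite: MoeglinVignerasWaldspurger1987, Chap. 1 I.17] -/
theorem hermForm_sub_left (v w y : n → S) : hermForm σ H (v - w) y = hermForm σ H v y - hermForm σ H w y := by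
  rw [sub_eq_add_neg, hermForm_add_left, hermForm_neg_left, ← sub_eq_add_neg]

/-- `h(x, v − w) = h(x, v) − h(x, w)`. [cite: MoeglinVignerasWaldspurger1987, Chap. 1 I.17] -/
theorem hermForm_sub_right (x v w : n → S) : hermForm σ H x (v - w) = hermForm σ H x v - hermForm σ H x w := by
  rw [sub_eq_add_neg, hermForm_add_right, hermForm_neg_right, ← sub_eq_add_neg]

/-- `h(0, y) = 0`. [cite: MoeglinVignerasWaldspurger1987, Chap. 1 I.17] -/
theorem hermForm_zero_left (y : n → S) : hermForm σ H 0 y = 0 := by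
  rw [← toLinearMapₛₗ₂'_eq_hermForm, map_zero, LinearMap.zero_apply]

/-- `h(x, 0) = 0`. [cite: MoeglinVignerasWaldspurger1987, Chap. 1 I.17] -/
theorem hermForm_zero_right (x : n → S) : hermForm σ H x 0 = 0 := by
  rw [← toLinearMapₛₗ₂'_eq_hermForm, map_zero]

omit [Fintype n] in
/-- `σ` fixes the basis vectors `eᵢ`. [folklore] -/
private theorem comp_single_one (i : n) : (⇑σ ∘ Pi.single i (1 : S) : n → S) = Pi.single i 1 := by
  classical
  funext k
  rcases eq_or_ne k i with rfl | hk
  · simp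
  · simp [Pi.single_eq_of_ne hk]

/-- **`h(eᵢ, eⱼ) = Hᵢⱼ`**: the Gram matrix of `h` in the standard basis is `H`. [cite: MoeglinVignerasWaldspurger1987, Chap. 1 I.17] -/
theorem hermForm_single_single (i j : n) : hermForm σ H (Pi.single i 1) (Pi.single j 1) = H i j := by
  classical
  rw [hermForm_apply, comp_single_one, single_one_dotProduct, Matrix.mulVec_single_one, Matrix.col_apply]

omit [DecidableEq n] in
/-- `h_H(g v, g w) = h_{(σ g)ᵀ H g}(v, w)` (the tree's `hermForm_mulVec_of_isometry` at `H' := (σ g)ᵀ H g`, reproved to keep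
the imports algebraic). [folklore] -/
private theorem hermForm_mulVec_mulVec_eq (g : Matrix n n S) (v w : n → S) :
    hermForm σ H (g *ᵥ v) (g *ᵥ w) = hermForm σ ((g.map σ)ᵀ * H * g) v w := by
  have h1 : (⇑σ ∘ (g *ᵥ v)) = g.map σ *ᵥ (⇑σ ∘ v) := funext fun i => RingHom.map_mulVec σ g v i
  rw [hermForm_apply, hermForm_apply, h1]
  calc (g.map σ *ᵥ (⇑σ ∘ v)) ⬝ᵥ (H *ᵥ (g *ᵥ w))
      = (((⇑σ ∘ v) ᵥ* (g.map σ)ᵀ) ᵥ* H ᵥ* g) ⬝ᵥ w := by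
        rw [Matrix.vecMul_transpose, Matrix.dotProduct_mulVec, Matrix.dotProduct_mulVec]
    _ = ((⇑σ ∘ v) ᵥ* ((g.map σ)ᵀ * H * g)) ⬝ᵥ w := by rw [Matrix.vecMul_vecMul, Matrix.vecMul_vecMul, Matrix.mul_assoc]
    _ = (⇑σ ∘ v) ⬝ᵥ (((g.map σ)ᵀ * H * g) *ᵥ w) := by rw [Matrix.dotProduct_mulVec]

/-- **matrix isometry criterion**: `(σ g)ᵀ H g = H ↔ ∀ v w, h(g v, g w) = h(v, w)`.
[cite: Dieudonne1971GroupesClassiques, Chap. II §5] -/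
theorem transpose_map_mul_mul_eq_iff_hermForm (g : Matrix n n S) :
    (g.map σ)ᵀ * H * g = H ↔ ∀ v w : n → S, hermForm σ H (g *ᵥ v) (g *ᵥ w) = hermForm σ H v w := by
  refine ⟨fun hg v w => hermForm_mulVec σ hg v w, fun hg => Matrix.ext fun i j => ?_⟩
  rw [← hermForm_single_single σ ((g.map σ)ᵀ * H * g) i j, ← hermForm_mulVec_mulVec_eq, hg, hermForm_single_single]

/-- **`g ∈ U(σ, H)` iff `g` preserves `h`**: `g ∈ unitaryGroupOfForm σ H ↔ ∀ v w, h(g v, g w) = h(v, w)`.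
[cite: Dieudonne1971GroupesClassiques, Chap. II §5] -/
theorem mem_unitaryGroupOfForm_iff_hermForm (g : GL n S) :
    g ∈ unitaryGroupOfForm σ H ↔
      ∀ v w : n → S, hermForm σ H ((g : Matrix n n S) *ᵥ v) ((g : Matrix n n S) *ᵥ w) = hermForm σ H v w := by
  rw [mem_unitaryGroupOfForm_iff, transpose_map_mul_mul_eq_iff_hermForm]

omit [DecidableEq n] in
/-- `(u ⊗ r) v = (r ⬝ᵥ v) u` over a commutative ring. [folklore] -/
private theorem vecMulVec_mulVec_eq_smul (u r v : n → S) : Matrix.vecMulVec u r *ᵥ v = (r ⬝ᵥ v) • u := by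
  rw [Matrix.vecMulVec_mulVec]
  funext i
  simp [mul_comm]

end Pairing

/-! ## §2 Root elements of the isotropic line (the Heisenberg unipotent radical `N_x`) -/

section Root

variable {S : Type*} [CommRing S] (σ : S →+* S) {n : Type*} [Fintype n] [DecidableEq n] (H : Matrix n n S)

/-- **the root element `T_x(w, z) = 1 + w ⊗ h(x,·) + x ⊗ (z h(x,·) − h(w,·))`** of the isotropic line `S x`
(`v ↦ v + h(x,v) w + (z h(x,v) − h(w,v)) x`): for `w = 0` the transvection `n_z : v ↦ v + z h(x,v) x`, for `w = b ⊥ x`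
and `z + σ z + h(b,b) = 0` the Eichler / Siegel element `n(b)`. [cite: Dieudonne1971GroupesClassiques, Chap. II §5] -/
def lineRoot (x w : n → S) (z : S) : Matrix n n S :=
  1 + Matrix.vecMulVec w (hermRow σ H x) + Matrix.vecMulVec x (z • hermRow σ H x - hermRow σ H w)

omit [DecidableEq n] in
/-- helper: the action of the two rank-one parts. [folklore] -/
private theorem lineRoot_aux_mulVec (x w : n → S) (z : S) (v : n → S) :
    (Matrix.vecMulVec w (hermRow σ H x) + Matrix.vecMulVec x (z • hermRow σ H x - hermRow σ H w)) *ᵥ v =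
      hermForm σ H x v • w + (z * hermForm σ H x v - hermForm σ H w v) • x := by
  rw [Matrix.add_mulVec, vecMulVec_mulVec_eq_smul, vecMulVec_mulVec_eq_smul, sub_dotProduct, smul_dotProduct,
    smul_eq_mul, hermRow_dotProduct, hermRow_dotProduct]

/-- **action**: `T_x(w, z) v = v + h(x,v) • w + (z h(x,v) − h(w,v)) • x`. [cite: Dieudonne1971GroupesClassiques, Chap. II §5] -/
theorem lineRoot_mulVec (x w : n → S) (z : S) (v : n → S) :
    lineRoot σ H x w z *ᵥ v = v + hermForm σ H x v • w + (z * hermForm σ H x v - hermForm σ H w v) • x := by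
  rw [lineRoot, add_assoc, Matrix.add_mulVec, Matrix.one_mulVec, lineRoot_aux_mulVec, add_assoc]

/-- **the transvections** `n_z = T_x(0, z) : v ↦ v + (z h(x,v)) • x` (the centre of `N_x`).
[cite: Dieudonne1971GroupesClassiques, Chap. II §5] -/
theorem lineRoot_zero_mulVec (x : n → S) (z : S) (v : n → S) :
    lineRoot σ H x 0 z *ᵥ v = v + (z * hermForm σ H x v) • x := by
  rw [lineRoot_mulVec, hermForm_zero_left, sub_zero, smul_zero, add_zero]

/-- `T_x(w, z)` fixes `x` (`h(x,x) = 0`, `h(w,x) = 0`). [cite: Dieudonne1971GroupesClassiques, Chap. II §5] -/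
theorem lineRoot_mulVec_self {x w : n → S} (z : S) (hx : hermForm σ H x x = 0) (hwx : hermForm σ H w x = 0) :
    lineRoot σ H x w z *ᵥ x = x := by
  rw [lineRoot_mulVec, hx, hwx, mul_zero, sub_zero, zero_smul, zero_smul, add_zero, add_zero]

/-- `T_x(w, z) v = v` for `v ⊥ x, w`. [cite: Dieudonne1971GroupesClassiques, Chap. II §5] -/
theorem lineRoot_mulVec_of_orth {x w : n → S} (z : S) {v : n → S} (hxv : hermForm σ H x v = 0)
    (hwv : hermForm σ H w v = 0) : lineRoot σ H x w z *ᵥ v = v := by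
  rw [lineRoot_mulVec, hxv, hwv, mul_zero, sub_zero, zero_smul, zero_smul, add_zero, add_zero]

/-- on a hyperbolic partner: `T_x(w, z) y = y + w + (z − h(w,y)) • x` (`h(x,y) = 1`).
[cite: Dieudonne1971GroupesClassiques, Chap. II §5] -/
theorem lineRoot_mulVec_partner {x y : n → S} (w : n → S) (z : S) (hxy : hermForm σ H x y = 1) :
    lineRoot σ H x w z *ᵥ y = y + w + (z - hermForm σ H w y) • x := by
  rw [lineRoot_mulVec, hxy, one_smul, mul_one]

/-- **the Heisenberg law of `N_x`**: `T_x(w, z) T_x(w', z') = T_x(w + w', z + z' − h(w, w'))`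
(`h(x,x) = 0`, `h(w,x) = 0`, `h(x,w') = 0`). [cite: Dieudonne1971GroupesClassiques, Chap. II §5] -/
theorem lineRoot_mul_lineRoot {x w w' : n → S} (z z' : S) (hx : hermForm σ H x x = 0)
    (hwx : hermForm σ H w x = 0) (hxw' : hermForm σ H x w' = 0) :
    lineRoot σ H x w z * lineRoot σ H x w' z' = lineRoot σ H x (w + w') (z + z' - hermForm σ H w w') := by
  refine Matrix.ext_iff_mulVec.2 fun v => ?_
  rw [← Matrix.mulVec_mulVec, lineRoot_mulVec, lineRoot_mulVec, lineRoot_mulVec]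
  simp only [hermForm_add_right, hermForm_smul_right, hermForm_add_left, hx, hwx, hxw', mul_zero, add_zero]
  module

/-- `T_x(0, 0) = 1`. [cite: Dieudonne1971GroupesClassiques, Chap. II §5] -/
theorem lineRoot_zero_zero (x : n → S) : lineRoot σ H x 0 0 = 1 := by
  refine Matrix.ext_iff_mulVec.2 fun v => ?_
  rw [lineRoot_zero_mulVec, zero_mul, zero_smul, add_zero, Matrix.one_mulVec]

/-- `T_x(w, z) T_x(−w, −z − h(w,w)) = 1`. [cite: Dieudonne1971GroupesClassiques, Chap. II §5] -/
theorem lineRoot_mul_lineRoot_neg {x w : n → S} (z : S) (hx : hermForm σ H x x = 0) (hwx : hermForm σ H w x = 0)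
    (hxw : hermForm σ H x w = 0) :
    lineRoot σ H x w z * lineRoot σ H x (-w) (-z - hermForm σ H w w) = 1 := by
  rw [lineRoot_mul_lineRoot σ H z _ hx hwx (by rw [hermForm_neg_right, hxw, neg_zero]), add_neg_cancel,
    hermForm_neg_right]
  convert lineRoot_zero_zero σ H x using 2
  ring

/-- `T_x(−w, −z − h(w,w)) T_x(w, z) = 1`. [cite: Dieudonne1971GroupesClassiques, Chap. II §5] -/
theorem lineRoot_neg_mul_lineRoot {x w : n → S} (z : S) (hx : hermForm σ H x x = 0) (hwx : hermForm σ H w x = 0)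
    (hxw : hermForm σ H x w = 0) :
    lineRoot σ H x (-w) (-z - hermForm σ H w w) * lineRoot σ H x w z = 1 := by
  rw [lineRoot_mul_lineRoot σ H _ z hx (by rw [hermForm_neg_left, hwx, neg_zero]) hxw, neg_add_cancel,
    hermForm_neg_left]
  convert lineRoot_zero_zero σ H x using 2
  ring

/-- **the root element as a unit** `T_x(w, z) ∈ GLₙ(S)` (inverse `T_x(−w, −z − h(w,w))`).
[cite: Dieudonne1971GroupesClassiques, Chap. II §5] -/
def lineRootGL {x w : n → S} (z : S) (hx : hermForm σ H x x = 0) (hwx : hermForm σ H w x = 0)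
    (hxw : hermForm σ H x w = 0) : GL n S where
  val := lineRoot σ H x w z
  inv := lineRoot σ H x (-w) (-z - hermForm σ H w w)
  val_inv := lineRoot_mul_lineRoot_neg σ H z hx hwx hxw
  inv_val := lineRoot_neg_mul_lineRoot σ H z hx hwx hxw

/-- underlying matrix of `lineRootGL`. [cite: Dieudonne1971GroupesClassiques, Chap. II §5] -/
@[simp] theorem coe_lineRootGL {x w : n → S} (z : S) (hx : hermForm σ H x x = 0) (hwx : hermForm σ H w x = 0)
    (hxw : hermForm σ H x w = 0) : ((lineRootGL σ H z hx hwx hxw : GL n S) : Matrix n n S) = lineRoot σ H x w z := rfl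

/-- **root elements are isometries**: `h(x,x) = 0`, `h(x,w) = 0`, `z + σ z + h(w,w) = 0` (and `σ` an involution, `H`
hermitian) give `h(T v, T v') = h(v, v')`. [cite: Dieudonne1971GroupesClassiques, Chap. II §5] -/
theorem lineRoot_isometry (hσ : ∀ s, σ (σ s) = s) (hH : (H.map σ)ᵀ = H) {x w : n → S} {z : S}
    (hx : hermForm σ H x x = 0) (hxw : hermForm σ H x w = 0) (hz : z + σ z + hermForm σ H w w = 0) (v v' : n → S) :
    hermForm σ H (lineRoot σ H x w z *ᵥ v) (lineRoot σ H x w z *ᵥ v') = hermForm σ H v v' := by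
  have hwx : hermForm σ H w x = 0 := by rw [← conj_hermForm σ H hσ hH, hxw, map_zero]
  have hvx : hermForm σ H v x = σ (hermForm σ H x v) := (conj_hermForm σ H hσ hH x v).symm
  have hvw : hermForm σ H v w = σ (hermForm σ H w v) := (conj_hermForm σ H hσ hH w v).symm
  rw [lineRoot_mulVec, lineRoot_mulVec]
  simp only [hermForm_add_left, hermForm_add_right, hermForm_smul_left_eq, hermForm_smul_right, map_sub, map_mul,
    hx, hxw, hwx, hvx, hvw]
  linear_combination (σ (hermForm σ H x v) * hermForm σ H x v') * hz

/-- **`T_x(w, z) ∈ U(σ, H)`** for `x` isotropic, `w ⊥ x` and `z + σ z + h(w,w) = 0`.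
[cite: Dieudonne1971GroupesClassiques, Chap. II §5] -/
theorem lineRootGL_mem (hσ : ∀ s, σ (σ s) = s) (hH : (H.map σ)ᵀ = H) {x w : n → S} {z : S}
    (hx : hermForm σ H x x = 0) (hwx : hermForm σ H w x = 0) (hxw : hermForm σ H x w = 0)
    (hz : z + σ z + hermForm σ H w w = 0) : lineRootGL σ H z hx hwx hxw ∈ unitaryGroupOfForm σ H := by
  rw [mem_unitaryGroupOfForm_iff_hermForm, coe_lineRootGL]
  exact lineRoot_isometry σ H hσ hH hx hxw hz

end Root

/-! ## §3 The Levi of the line: dilations `x ↦ α x`, `y ↦ β y` -/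

section Dilation

variable {S : Type*} [CommRing S] (σ : S →+* S) {n : Type*} [Fintype n] [DecidableEq n] (H : Matrix n n S)

/-- **the dilation `D(α, β) = 1 + x ⊗ (α−1) h(y,·) + y ⊗ (β−1) h(x,·)`** of the hyperbolic pair `(x, y)`: `x ↦ α x`,
`y ↦ β y`, identity on `{x, y}^⊥`; the Levi element `m_λ` of `λ ∈ Sˣ` is `D(λ, (σλ)⁻¹)`.
[cite: Dieudonne1971GroupesClassiques, Chap. II §5] -/
def lineDilation (x y : n → S) (α β : S) : Matrix n n S :=
  1 + Matrix.vecMulVec x ((α - 1) • hermRow σ H y) + Matrix.vecMulVec y ((β - 1) • hermRow σ H x)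

omit [DecidableEq n] in
/-- helper: the action of the two rank-one parts. [folklore] -/
private theorem lineDilation_aux_mulVec (x y : n → S) (α β : S) (v : n → S) :
    (Matrix.vecMulVec x ((α - 1) • hermRow σ H y) + Matrix.vecMulVec y ((β - 1) • hermRow σ H x)) *ᵥ v =
      ((α - 1) * hermForm σ H y v) • x + ((β - 1) * hermForm σ H x v) • y := by
  rw [Matrix.add_mulVec, vecMulVec_mulVec_eq_smul, vecMulVec_mulVec_eq_smul, smul_dotProduct, smul_dotProduct,
    smul_eq_mul, smul_eq_mul, hermRow_dotProduct, hermRow_dotProduct]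

/-- **action**: `D(α, β) v = v + ((α−1) h(y,v)) • x + ((β−1) h(x,v)) • y`. [cite: Dieudonne1971GroupesClassiques, Chap. II §5] -/
theorem lineDilation_mulVec (x y : n → S) (α β : S) (v : n → S) :
    lineDilation σ H x y α β *ᵥ v = v + ((α - 1) * hermForm σ H y v) • x + ((β - 1) * hermForm σ H x v) • y := by
  rw [lineDilation, add_assoc, Matrix.add_mulVec, Matrix.one_mulVec, lineDilation_aux_mulVec, add_assoc]

/-- `D(α, β) x = α x` (`h(x,x) = 0`, `h(y,x) = 1`). [cite: Dieudonne1971GroupesClassiques, Chap. II §5] -/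
theorem lineDilation_mulVec_left {x y : n → S} (α β : S) (hx : hermForm σ H x x = 0) (hyx : hermForm σ H y x = 1) :
    lineDilation σ H x y α β *ᵥ x = α • x := by
  rw [lineDilation_mulVec, hx, hyx, mul_one, mul_zero, zero_smul, add_zero]
  module

/-- `D(α, β) y = β y` (`h(y,y) = 0`, `h(x,y) = 1`). [cite: Dieudonne1971GroupesClassiques, Chap. II §5] -/
theorem lineDilation_mulVec_partner {x y : n → S} (α β : S) (hy : hermForm σ H y y = 0)
    (hxy : hermForm σ H x y = 1) : lineDilation σ H x y α β *ᵥ y = β • y := by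
  rw [lineDilation_mulVec, hy, hxy, mul_one, mul_zero, zero_smul, add_zero]
  module

/-- `D(α, β) v = v` for `v ⊥ x, y`. [cite: Dieudonne1971GroupesClassiques, Chap. II §5] -/
theorem lineDilation_mulVec_of_orth {x y : n → S} (α β : S) {v : n → S} (hxv : hermForm σ H x v = 0)
    (hyv : hermForm σ H y v = 0) : lineDilation σ H x y α β *ᵥ v = v := by
  rw [lineDilation_mulVec, hxv, hyv, mul_zero, mul_zero, zero_smul, zero_smul, add_zero, add_zero]

/-- `D(1, 1) = 1`. [cite: Dieudonne1971GroupesClassiques, Chap. II §5] -/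
theorem lineDilation_one_one (x y : n → S) : lineDilation σ H x y 1 1 = 1 := by
  refine Matrix.ext_iff_mulVec.2 fun v => ?_
  rw [lineDilation_mulVec, sub_self, zero_mul, zero_mul, zero_smul, zero_smul, add_zero, add_zero, Matrix.one_mulVec]

/-- **dilations are multiplicative**: `D(α, β) D(α', β') = D(α α', β β')` on a hyperbolic pair.
[cite: Dieudonne1971GroupesClassiques, Chap. II §5] -/
theorem lineDilation_mul_lineDilation {x y : n → S} (α β α' β' : S) (hx : hermForm σ H x x = 0)
    (hy : hermForm σ H y y = 0) (hxy : hermForm σ H x y = 1) (hyx : hermForm σ H y x = 1) :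
    lineDilation σ H x y α β * lineDilation σ H x y α' β' = lineDilation σ H x y (α * α') (β * β') := by
  refine Matrix.ext_iff_mulVec.2 fun v => ?_
  rw [← Matrix.mulVec_mulVec, lineDilation_mulVec σ H x y α' β', Matrix.mulVec_add, Matrix.mulVec_add,
    Matrix.mulVec_smul, Matrix.mulVec_smul, lineDilation_mulVec_left σ H α β hx hyx,
    lineDilation_mulVec_partner σ H α β hy hxy, lineDilation_mulVec, lineDilation_mulVec]
  module

/-- **the dilation as a unit** `D(α, β) ∈ GLₙ(S)` for `α, β ∈ Sˣ` (inverse `D(α⁻¹, β⁻¹)`).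
[cite: Dieudonne1971GroupesClassiques, Chap. II §5] -/
def lineDilationGL {x y : n → S} (hx : hermForm σ H x x = 0) (hy : hermForm σ H y y = 0)
    (hxy : hermForm σ H x y = 1) (hyx : hermForm σ H y x = 1) (α β : Sˣ) : GL n S where
  val := lineDilation σ H x y α β
  inv := lineDilation σ H x y ↑α⁻¹ ↑β⁻¹
  val_inv := by rw [lineDilation_mul_lineDilation σ H _ _ _ _ hx hy hxy hyx, Units.mul_inv, Units.mul_inv,
    lineDilation_one_one]
  inv_val := by rw [lineDilation_mul_lineDilation σ H _ _ _ _ hx hy hxy hyx, Units.inv_mul, Units.inv_mul,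
    lineDilation_one_one]

/-- underlying matrix of `lineDilationGL`. [cite: Dieudonne1971GroupesClassiques, Chap. II §5] -/
@[simp] theorem coe_lineDilationGL {x y : n → S} (hx : hermForm σ H x x = 0) (hy : hermForm σ H y y = 0)
    (hxy : hermForm σ H x y = 1) (hyx : hermForm σ H y x = 1) (α β : Sˣ) :
    ((lineDilationGL σ H hx hy hxy hyx α β : GL n S) : Matrix n n S) = lineDilation σ H x y α β := rfl

/-- inverse of `lineDilationGL`. [cite: Dieudonne1971GroupesClassiques, Chap. II §5] -/
@[simp] theorem coe_lineDilationGL_inv {x y : n → S} (hx : hermForm σ H x x = 0) (hy : hermForm σ H y y = 0)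
    (hxy : hermForm σ H x y = 1) (hyx : hermForm σ H y x = 1) (α β : Sˣ) :
    (((lineDilationGL σ H hx hy hxy hyx α β)⁻¹ : GL n S) : Matrix n n S) = lineDilation σ H x y ↑α⁻¹ ↑β⁻¹ := rfl

/-- **dilations are isometries when `σ(α) β = 1`** (`σ` an involution, `H` hermitian, `(x, y)` a hyperbolic pair).
[cite: Dieudonne1971GroupesClassiques, Chap. II §5] -/
theorem lineDilation_isometry (hσ : ∀ s, σ (σ s) = s) (hH : (H.map σ)ᵀ = H) {x y : n → S}
    (hx : hermForm σ H x x = 0) (hy : hermForm σ H y y = 0) (hxy : hermForm σ H x y = 1) {α β : S}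
    (hαβ : σ α * β = 1) (v v' : n → S) :
    hermForm σ H (lineDilation σ H x y α β *ᵥ v) (lineDilation σ H x y α β *ᵥ v') = hermForm σ H v v' := by
  have hyx : hermForm σ H y x = 1 := by rw [← conj_hermForm σ H hσ hH, hxy, map_one]
  have hβα : σ β * α = 1 := by
    have h := congrArg σ hαβ
    rwa [map_mul, hσ, map_one, mul_comm] at h
  have hvx : hermForm σ H v x = σ (hermForm σ H x v) := (conj_hermForm σ H hσ hH x v).symm
  have hvy : hermForm σ H v y = σ (hermForm σ H y v) := (conj_hermForm σ H hσ hH y v).symm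
  rw [lineDilation_mulVec, lineDilation_mulVec]
  simp only [hermForm_add_left, hermForm_add_right, hermForm_smul_left_eq, hermForm_smul_right, map_sub, map_mul,
    map_one, hx, hy, hxy, hyx, hvx, hvy]
  linear_combination (σ (hermForm σ H y v) * hermForm σ H x v') * hαβ +
    (σ (hermForm σ H x v) * hermForm σ H y v') * hβα

/-- **`D(α, β) ∈ U(σ, H)`** when `σ(α) β = 1`; in particular the Levi element `m_λ = D(λ, (σλ)⁻¹)`.
[cite: Dieudonne1971GroupesClassiques, Chap. II §5] -/
theorem lineDilationGL_mem (hσ : ∀ s, σ (σ s) = s) (hH : (H.map σ)ᵀ = H) {x y : n → S}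
    (hx : hermForm σ H x x = 0) (hy : hermForm σ H y y = 0) (hxy : hermForm σ H x y = 1)
    (hyx : hermForm σ H y x = 1) {α β : Sˣ} (hαβ : σ α * β = 1) :
    lineDilationGL σ H hx hy hxy hyx α β ∈ unitaryGroupOfForm σ H := by
  rw [mem_unitaryGroupOfForm_iff_hermForm, coe_lineDilationGL]
  exact lineDilation_isometry σ H hσ hH hx hy hxy hαβ

/-- **the Levi normalises `N_x`**: `D(α, β) T_x(w, z) = T_x(β′ w, α β′ z) D(α, β)` for `w ⊥ x, y`, `β β′ = 1` and
`σ(β′) = α` (i.e. `σ(β) α = 1`): the Levi acts on `N_x`, on its centre `{T_x(0, z)}` by `z ↦ α β′ z = λ σ(λ) z` for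
`m_λ = D(λ, (σλ)⁻¹)`. [cite: Dieudonne1971GroupesClassiques, Chap. II §5] -/
theorem lineDilation_mul_lineRoot {x y w : n → S} (z α β β' : S)
    (hx : hermForm σ H x x = 0) (hxy : hermForm σ H x y = 1) (hyx : hermForm σ H y x = 1)
    (hxw : hermForm σ H x w = 0) (hwx : hermForm σ H w x = 0) (hyw : hermForm σ H y w = 0)
    (hwy : hermForm σ H w y = 0) (hβ : β * β' = 1) (hσβ : σ β' = α) :
    lineDilation σ H x y α β * lineRoot σ H x w z = lineRoot σ H x (β' • w) (α * β' * z) * lineDilation σ H x y α β := by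
  refine Matrix.ext_iff_mulVec.2 fun v => ?_
  simp only [← Matrix.mulVec_mulVec, lineRoot_mulVec, lineDilation_mulVec, Matrix.mulVec_add, Matrix.mulVec_smul,
    hermForm_smul_left_eq, hx, hxy, hyx, hxw, hwx, hyw, hwy, hσβ, mul_zero, mul_one, add_zero, sub_zero, zero_smul,
    smul_add, smul_smul]
  match_scalars <;>
    first
    | ring1
    | linear_combination (hermForm σ H x v) * hβ
    | linear_combination (-(hermForm σ H x v)) * hβ
    | linear_combination (α * z * hermForm σ H x v) * hβ
    | linear_combination (-(α * z * hermForm σ H x v)) * hβ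

/-- the same as a CONJUGATION by the unit `D(α, β)`, `α, β ∈ Sˣ`, `σ(β⁻¹) = α`:
`D(α, β) T_x(w, z) D(α, β)⁻¹ = T_x(β⁻¹ w, α β⁻¹ z)`. [cite: Dieudonne1971GroupesClassiques, Chap. II §5] -/
theorem lineDilation_mul_lineRoot_mul_lineDilation_inv {x y w : n → S} (z : S) (α β : Sˣ)
    (hx : hermForm σ H x x = 0) (hy : hermForm σ H y y = 0) (hxy : hermForm σ H x y = 1)
    (hyx : hermForm σ H y x = 1) (hxw : hermForm σ H x w = 0) (hwx : hermForm σ H w x = 0)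
    (hyw : hermForm σ H y w = 0) (hwy : hermForm σ H w y = 0) (hσβ : σ (↑β⁻¹ : S) = α) :
    lineDilation σ H x y α β * lineRoot σ H x w z * lineDilation σ H x y ↑α⁻¹ ↑β⁻¹ =
      lineRoot σ H x ((↑β⁻¹ : S) • w) ((α : S) * ↑β⁻¹ * z) := by
  rw [lineDilation_mul_lineRoot σ H z (α : S) (β : S) (↑β⁻¹ : S) hx hxy hyx hxw hwx hyw hwy (Units.mul_inv β) hσβ,
    Matrix.mul_assoc, lineDilation_mul_lineDilation σ H _ _ _ _ hx hy hxy hyx, Units.mul_inv, Units.mul_inv,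
    lineDilation_one_one, Matrix.mul_one]

end Dilation

/-! ## §4 The decomposition `V = S x ⊕ S y ⊕ {x, y}^⊥` -/

section Decomposition

variable {S : Type*} [CommRing S] (σ : S →+* S) {n : Type*} [Fintype n] [DecidableEq n] (H : Matrix n n S)

/-- **the `{x, y}^⊥`-component** `v − h(y,v) x − h(x,v) y` of `v` along the hyperbolic pair.
[cite: Dieudonne1971GroupesClassiques, Chap. II §5] -/
def lineProj (x y v : n → S) : n → S := v - hermForm σ H y v • x - hermForm σ H x v • y

omit [DecidableEq n] in
/-- `v = h(y,v) • x + h(x,v) • y + lineProj v`. [cite: Dieudonne1971GroupesClassiques, Chap. II §5] -/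
theorem lineProj_decomp (x y v : n → S) : v = hermForm σ H y v • x + hermForm σ H x v • y + lineProj σ H x y v := by
  rw [lineProj]; abel

/-- `h(x, lineProj v) = 0` (`h(x,x) = 0`, `h(x,y) = 1`). [cite: Dieudonne1971GroupesClassiques, Chap. II §5] -/
theorem hermForm_left_lineProj {x y : n → S} (hx : hermForm σ H x x = 0) (hxy : hermForm σ H x y = 1) (v : n → S) :
    hermForm σ H x (lineProj σ H x y v) = 0 := by
  rw [lineProj, hermForm_sub_right, hermForm_sub_right, hermForm_smul_right, hermForm_smul_right, hx, hxy]; ring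

/-- `h(y, lineProj v) = 0` (`h(y,y) = 0`, `h(y,x) = 1`). [cite: Dieudonne1971GroupesClassiques, Chap. II §5] -/
theorem hermForm_partner_lineProj {x y : n → S} (hy : hermForm σ H y y = 0) (hyx : hermForm σ H y x = 1)
    (v : n → S) : hermForm σ H y (lineProj σ H x y v) = 0 := by
  rw [lineProj, hermForm_sub_right, hermForm_sub_right, hermForm_smul_right, hermForm_smul_right, hy, hyx]; ring

omit [DecidableEq n] in
/-- `lineProj v = v` for `v ⊥ x, y`. [cite: Dieudonne1971GroupesClassiques, Chap. II §5] -/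
theorem lineProj_of_orth (x y : n → S) {v : n → S} (hxv : hermForm σ H x v = 0) (hyv : hermForm σ H y v = 0) :
    lineProj σ H x y v = v := by
  rw [lineProj, hxv, hyv, zero_smul, zero_smul, sub_zero, sub_zero]

/-- **the orthogonal complement `{x, y}^⊥ = {v ∣ h(x,v) = 0, h(y,v) = 0}`** of the hyperbolic plane, as a submodule
(intersection of the kernels of the linear functionals `h(x,·)`, `h(y,·)`). [cite: Dieudonne1971GroupesClassiques, Chap. II §5] -/
def lineCompl (x y : n → S) : Submodule S (n → S) :=
  LinearMap.ker (Matrix.toLinearMapₛₗ₂' S σ (RingHom.id S) H x) ⊓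
    LinearMap.ker (Matrix.toLinearMapₛₗ₂' S σ (RingHom.id S) H y)

/-- membership: `v ∈ {x,y}^⊥ ↔ h(x,v) = 0 ∧ h(y,v) = 0`. [cite: Dieudonne1971GroupesClassiques, Chap. II §5] -/
theorem mem_lineCompl_iff (x y v : n → S) : v ∈ lineCompl σ H x y ↔ hermForm σ H x v = 0 ∧ hermForm σ H y v = 0 := by
  rw [lineCompl, Submodule.mem_inf, LinearMap.mem_ker, LinearMap.mem_ker, toLinearMapₛₗ₂'_eq_hermForm,
    toLinearMapₛₗ₂'_eq_hermForm]

/-- `lineProj v ∈ {x, y}^⊥` on a hyperbolic pair. [cite: Dieudonne1971GroupesClassiques, Chap. II §5] -/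
theorem lineProj_mem_lineCompl {x y : n → S} (hx : hermForm σ H x x = 0) (hy : hermForm σ H y y = 0)
    (hxy : hermForm σ H x y = 1) (hyx : hermForm σ H y x = 1) (v : n → S) : lineProj σ H x y v ∈ lineCompl σ H x y :=
  (mem_lineCompl_iff σ H x y _).2 ⟨hermForm_left_lineProj σ H hx hxy v, hermForm_partner_lineProj σ H hy hyx v⟩

/-- root elements with `w ∈ {x,y}^⊥` and dilations FIX `{x, y}^⊥` elementwise modulo `x`: `T_x(w,z) v = v − h(w,v) • x`
for `v ∈ {x,y}^⊥`. [cite: Dieudonne1971GroupesClassiques, Chap. II §5] -/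
theorem lineRoot_mulVec_of_mem_lineCompl {x y : n → S} (w : n → S) (z : S) {v : n → S} (hv : v ∈ lineCompl σ H x y) :
    lineRoot σ H x w z *ᵥ v = v - hermForm σ H w v • x := by
  rw [lineRoot_mulVec, ((mem_lineCompl_iff σ H x y v).1 hv).1, zero_smul, add_zero, mul_zero, zero_sub, neg_smul,
    sub_eq_add_neg]

end Decomposition

/-! ## §5 Over a field: hyperbolic partners and an orthogonal basis of `{x, y}^⊥` -/

section Field

variable {K : Type*} [Field K] (σ : K →+* K) {n : Type*} [Fintype n] [DecidableEq n] (H : Matrix n n K)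

/-- **a non-zero isotropic vector has a hyperbolic partner**: `2 ≠ 0`, `σ` an involution, `H` hermitian with
`det H ≠ 0`, `h(x,x) = 0`, `x ≠ 0` ⇒ `∃ y, h(y,y) = 0 ∧ h(x,y) = 1` (`y = y₀ − ½ h(y₀,y₀) x` for any `y₀` with
`h(x,y₀) = 1`). [cite: Dieudonne1971GroupesClassiques, Chap. II §5] -/
theorem exists_hyperbolic_partner_hermForm (h2 : (2 : K) ≠ 0) (hσ : ∀ s, σ (σ s) = s) (hH : (H.map σ)ᵀ = H)
    (hHd : H.det ≠ 0) {x : n → K} (hx : hermForm σ H x x = 0) (hx0 : x ≠ 0) :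
    ∃ y : n → K, hermForm σ H y y = 0 ∧ hermForm σ H x y = 1 := by
  classical
  haveI : NeZero (2 : K) := ⟨h2⟩
  -- the functional `h(x, ·)` is non-zero: its row `(σ x)ᵀ H` is
  have hrow : hermRow σ H x ≠ 0 := by
    intro h0
    have hinj := Matrix.vecMul_injective_iff_isUnit.2 ((Matrix.isUnit_iff_isUnit_det H).2 (Ne.isUnit hHd))
    have hσx : (⇑σ ∘ x) = 0 :=
      hinj (show (⇑σ ∘ x) ᵥ* H = (0 : n → K) ᵥ* H by rw [Matrix.zero_vecMul]; exact h0)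
    apply hx0
    funext i
    have hi := congrFun hσx i
    simp only [Function.comp_apply, Pi.zero_apply] at hi
    have := congrArg σ hi
    rwa [hσ, map_zero] at this
  obtain ⟨i, hi⟩ := Function.ne_iff.1 hrow
  -- `y₀` with `h(x, y₀) = 1`
  obtain ⟨y₀, hxy₀⟩ : ∃ y₀ : n → K, hermForm σ H x y₀ = 1 :=
    ⟨(hermRow σ H x i)⁻¹ • Pi.single i 1, by
      rw [hermForm_smul_right, ← hermRow_dotProduct, dotProduct_single_one, inv_mul_cancel₀ hi]⟩
  have hy₀x : hermForm σ H y₀ x = 1 := by rw [← conj_hermForm σ H hσ hH, hxy₀, map_one]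
  -- the correction `c = ½ h(y₀, y₀)`: `c + σ c = h(y₀, y₀)`
  obtain ⟨c, hc⟩ : ∃ c : K, c + σ c = hermForm σ H y₀ y₀ :=
    ⟨hermForm σ H y₀ y₀ / 2, by rw [map_div₀, conj_hermForm σ H hσ hH, map_ofNat, add_halves]⟩
  refine ⟨y₀ - c • x, ?_, ?_⟩
  · simp only [hermForm_sub_left, hermForm_sub_right, hermForm_smul_left_eq, hermForm_smul_right, hx, hxy₀, hy₀x]
    linear_combination (-1 : K) * hc
  · simp only [hermForm_sub_right, hermForm_smul_right, hx, hxy₀, mul_zero, sub_zero]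

/-- **`{x, y}^⊥` has an `h`-orthogonal basis** (`2 ≠ 0`, `σ δ = −δ` for some `δ ≠ 0`, `σ` an involution, `H`
hermitian), by the tree's `Semilinear.exists_orthogonal_basis_of_isSymm` for the restriction of `B_H` to `{x,y}^⊥`.
[cite: Lang2002, Ch. XV §5] -/
theorem exists_orthogonal_basis_lineCompl (h2 : (2 : K) ≠ 0) {δ : K} (hδ : δ ≠ 0) (hσδ : σ δ = -δ)
    (hσ : ∀ s, σ (σ s) = s) (hH : (H.map σ)ᵀ = H) (x y : n → K) :
    ∃ b : Module.Basis (Fin (Module.finrank K (lineCompl σ H x y))) K (lineCompl σ H x y),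
      ∀ i j, i ≠ j → hermForm σ H (b i : n → K) (b j : n → K) = 0 := by
  set B := (Matrix.toLinearMapₛₗ₂' K σ (RingHom.id K) H).domRestrict₁₂ (lineCompl σ H x y) (lineCompl σ H x y)
    with hB
  have hBs : B.IsSymm := LinearMap.isSymm_def.2 fun v w => by
    rw [hB, LinearMap.domRestrict₁₂_apply, LinearMap.domRestrict₁₂_apply]
    exact LinearMap.isSymm_def.1 (isSymm_toLinearMapₛₗ₂' σ H hσ hH) v w
  obtain ⟨b, hb⟩ := Literature.LinearAlgebra.Semilinear.exists_orthogonal_basis_of_isSymm h2 hδ hσδ hBs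
  refine ⟨b, fun i j hij => ?_⟩
  have h : B (b i) (b j) = 0 := hb hij
  rw [hB, LinearMap.domRestrict₁₂_apply, toLinearMapₛₗ₂'_eq_hermForm] at h
  exact h

end Field

end Literature.NumberTheory.Automorphic.UnitaryGroup

end
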